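import Summits.BirchSwinnertonDyer.BirchSwinnertonDyer.Theorems.SylvesterTwoHeegnerIndexCMFlipLayerL1
import HarnessLib

/-!
# (S9b) of leaf (L1) at `p ≡ 7 (mod 9)`, crux `UpperOffV0HSYPlus` (stmt-BirchSwinnertonDyer-19804): CANONICAL PER-LEVEL
# DATA for the halved assembly — generators, CM points, lifted generators, and the TOWER-FIXING automorphisms

Skeleton VARIANT M 406ca288e244d392, stub `stub_layerL1Seven`; planner D507 (4), D510.  The rows' assembly at `p ≡ 4 (9)`
(#H-d2 `layerL1Four_of_named_of_flip`) chooses, per Kolyvagin prime `ℓ` and per pair level `n = ℓℓ′`, a generator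
`σ_ℓ` (`RingClassGalOverCyclic`), HSY's CM point `y_ℓ` / `y_n` (#R-a) and lifted generators (#H-c1) by `Classical.choose`
inside one proof.  The `p ≡ 7 (9)` assembly needs IN ADDITION, per level, the TOWER-FIXING automorphism `φ_n ∈ Aut_K K[9pn]`
(restricting to the bottom involution `s`, fixing `y_n`) with its LOCAL face at `w ∣ 3` — supplied by the displayed
hypothesis `hTFn` (memo two §67.2 (W2-b)/(W2-a,d); a CELL input, not proved).  To keep the assembly within one file this
file packages ALL these choices as functions of the level with their specifications (`exists_halfChoices`); nothing
mathematical happens here beyond #H-d2's choices and `Classical.choose` on `hTFn`.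

Theorems only; no `def`, no `sorry`, no new `Prop`.  HONEST LABEL: `hTFn` is a displayed hypothesis (cell lemma W2,
unrefereed); nothing asserted on 19804; no stub closed; X12.CMAtTwo NOT proved; BSD is not proved by any of this.
`--supports stmt-BirchSwinnertonDyer-19804 --as helper`.
-/

set_option linter.dupNamespace false
set_option autoImplicit false

noncomputable section

open scoped Classical Pointwise

namespace Summit.BirchSwinnertonDyer.BirchSwinnertonDyer.Theorems.SylvesterTwoCMHalf

open WeierstrassCurve Field NumberField IsDedekindDomain Finset
open Literature.NumberTheory.EllipticCurves Literature.NumberTheory.GaloisRepresentations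
  Literature.NumberTheory.EllipticCurves.ModularForms
  Literature.NumberTheory.EllipticCurves.HuShuYin2019
  Literature.NumberTheory.EllipticCurves.KolyvaginCocycle
  Literature.NumberTheory.EllipticCurves.RingClassField
  Summit.BirchSwinnertonDyer.BirchSwinnertonDyer.Theses.SylvesterTwoHeegnerIndex
  Summit.BirchSwinnertonDyer.BirchSwinnertonDyer.Theorems
  Summit.BirchSwinnertonDyer.BirchSwinnertonDyer.Theorems.SylvesterTwoCoupledDescentCebotarev
  Summit.BirchSwinnertonDyer.BirchSwinnertonDyer.Theorems.SylvesterTwoCMData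
  Summit.BirchSwinnertonDyer.BirchSwinnertonDyer.Theorems.SylvesterTwoCMFlip
  Summit.BirchSwinnertonDyer.Rank1Residual.X11b Summit.BirchSwinnertonDyer.Rank1Residual.X11b.RingClassTower

variable {K : Type} [Field K] [NumberField K]

set_option maxHeartbeats 1600000 in
/-- **Canonical per-level data for the halved assembly.**  For `K ∋ ω` quadratic, `p ≡ 1 (3)` prime, a degree-free
parametrisation datum `Dt`, embeddings `emb m : K[m] → K̄` over `K`, a predicate `Kol` implying the stub's Kolyvagin clause,
the bottom involution `s`, and the displayed TOWER FIXING `hTFn` (for every level `n ≠ 0` with all prime factors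
`≡ 2 (3)`, every `K[9p] ≤ K[9pn]`, every `K`-embedding of `K[9pn]` and every `y` over `Dt.φ(τ_n)`: an automorphism
`φ ∈ Aut_K K[9pn]` restricting to `s` with `φ·y = y`, and at each `v ∣ 3` an open odd-index `Φ ≤ Γ_{K_v}` acting on the
embedded `K[9pn]` through `{1, φ}`): functions `σf, yf, φf` (per prime), `σL, y2, φ2` (per pair level) with: `⟨σ_ℓ⟩ =
Gal(K[9pℓ]/K[9p])`, `y_ℓ ↦ Dt.φ(τ_ℓ)`, `φ_ℓ` restricts to `s` and fixes `y_ℓ` (+ local face); `⟨σL n a b⟩ = Gal(K[9pn]/K[9pa])`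
lifting `σ_b`; `y_n ↦ Dt.φ(τ_n)`, `φ2 n` restricts to `s` and fixes `y_n` (+ local face).
[cite: GrossLMS1991, §3 (3.3)–(3.7), §4 (4.1)] [cite: HuShuYin2019, §4.1 p. 10 (x_n, y_n)] -/
theorem exists_halfChoices {ω : K} (hω : ω ^ 2 + ω + 1 = 0) (h2 : Module.finrank ℚ K = 2) (ι : K →+* ℂ)
    (Dt : ModularParametrizationData (⟨0, 0, 1, 0, -1⟩ : WeierstrassCurve ℚ) 243) {p : ℕ} (hp : p.Prime) (hp3 : p % 3 = 1)
    (Kol : ℕ → Prop)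
    (hKol : ∀ ℓ, Kol ℓ → ℓ.Prime ∧ ¬ ℓ ∣ (cubeSumCurve (3 * (p : ℚ) ^ 2)).conductorNorm ℤ ∧
      ¬ ℓ ∣ (cubeSumCurve (p : ℚ)).conductorNorm ℤ ∧ ¬ ((ℓ : ℤ) ∣ NumberField.discr K) ∧ ℓ ≠ 2 ∧
      (Ideal.span {(ℓ : 𝓞 K)}).IsPrime ∧
      FrobEqFrobInfty (cubeSumCurve (3 * (p : ℚ) ^ 2)) K 2 ℓ ∧ FrobEqFrobInfty (cubeSumCurve (p : ℚ)) K 2 ℓ)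
    (emb : (m : ℕ) → (ringClassField K ι m →+* AlgebraicClosure K))
    (hembK : ∀ m (k : K), emb m (algebraMap K (ringClassField K ι m) k) = algebraMap K (AlgebraicClosure K) k)
    (s : ringClassField K ι (9 * p) ≃ₐ[K] ringClassField K ι (9 * p))
    (hTFn : ∀ (n : ℕ), n ≠ 0 → (∀ q ∈ n.primeFactors, q % 3 = 2) →
      ∀ (hle : ringClassField K ι (9 * p) ≤ ringClassField K ι (9 * p * n))
        (e : ringClassField K ι (9 * p * n) →+* AlgebraicClosure K),
        (∀ k : K, e (algebraMap K (ringClassField K ι (9 * p * n)) k) = algebraMap K (AlgebraicClosure K) k) →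
      ∀ (y : ((⟨0, 0, 1, 0, -1⟩ : WeierstrassCurve ℚ).baseChange (ringClassField K ι (9 * p * n))).toAffine.Point),
        Affine.Point.map (W' := (⟨0, 0, 1, 0, -1⟩ : WeierstrassCurve ℚ)) (ringClassField K ι (9 * p * n)).subtype.toRatAlgHom y =
          Dt.φ (heegnerTau ((n : ℤ) ^ 2 * (81 * ((p : ℤ) ^ 2 + 4 * p + 16)),
            (n : ℤ) * (-(9 * (4 * (p : ℤ) ^ 2 + 17 * p + 72))), 4 * (p : ℤ) ^ 2 + 18 * p + 81)) →
      ∃ φ : ringClassField K ι (9 * p * n) ≃ₐ[K] ringClassField K ι (9 * p * n),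
        (∀ x : ringClassField K ι (9 * p), φ (RingClassField.inclusion ι hle x) = RingClassField.inclusion ι hle (s x)) ∧
        pointGalHom (⟨0, 0, 1, 0, -1⟩ : WeierstrassCurve ℚ) (ringClassField K ι (9 * p * n)) (φ.restrictScalars ℚ) y = y ∧
        ∀ (v : HeightOneSpectrum (𝓞 K)), ((3 : ℕ) : 𝓞 K) ∈ v.asIdeal →
          ∃ Φ : Subgroup (absoluteGaloisGroup (v.adicCompletion K)),
            IsOpen (Φ : Set (absoluteGaloisGroup (v.adicCompletion K))) ∧ IsCoprime (Φ.index : ℤ) ((2 : ℕ) : ℤ) ∧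
            ∀ τ ∈ Φ, (∀ x : ringClassField K ι (9 * p * n), (show AlgebraicClosure K ≃ₐ[K] AlgebraicClosure K from
                resGal (K := K) (v.adicCompletion K) τ) (e x) = e x) ∨
              (∀ x : ringClassField K ι (9 * p * n), (show AlgebraicClosure K ≃ₐ[K] AlgebraicClosure K from
                resGal (K := K) (v.adicCompletion K) τ) (e x) = e (φ x))) :
    ∃ (σf : (ℓ : ℕ) → (ringClassField K ι (9 * p * ℓ) ≃ₐ[ℚ] ringClassField K ι (9 * p * ℓ)))
      (yf : (ℓ : ℕ) → ((⟨0, 0, 1, 0, -1⟩ : WeierstrassCurve ℚ).baseChange (ringClassField K ι (9 * p * ℓ))).toAffine.Point)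
      (φf : (ℓ : ℕ) → (ringClassField K ι (9 * p * ℓ) ≃ₐ[K] ringClassField K ι (9 * p * ℓ)))
      (σL : (n a b : ℕ) → (ringClassField K ι (9 * p * n) ≃ₐ[ℚ] ringClassField K ι (9 * p * n)))
      (y2 : (n : ℕ) → ((⟨0, 0, 1, 0, -1⟩ : WeierstrassCurve ℚ).baseChange (ringClassField K ι (9 * p * n))).toAffine.Point)
      (φ2 : (n : ℕ) → (ringClassField K ι (9 * p * n) ≃ₐ[K] ringClassField K ι (9 * p * n))),
      (∀ ℓ, Kol ℓ →
        Subgroup.zpowers (σf ℓ) = ringClassGalOver ι (9 * p * ℓ) (9 * p) ∧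
        Affine.Point.map (W' := (⟨0, 0, 1, 0, -1⟩ : WeierstrassCurve ℚ)) (ringClassField K ι (9 * p * ℓ)).subtype.toRatAlgHom (yf ℓ) =
          Dt.φ (heegnerTau ((ℓ : ℤ) ^ 2 * (81 * ((p : ℤ) ^ 2 + 4 * p + 16)),
            (ℓ : ℤ) * (-(9 * (4 * (p : ℤ) ^ 2 + 17 * p + 72))), 4 * (p : ℤ) ^ 2 + 18 * p + 81)) ∧
        (∀ (hle : ringClassField K ι (9 * p) ≤ ringClassField K ι (9 * p * ℓ)) (x : ringClassField K ι (9 * p)),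
          φf ℓ (RingClassField.inclusion ι hle x) = RingClassField.inclusion ι hle (s x)) ∧
        pointGalHom (⟨0, 0, 1, 0, -1⟩ : WeierstrassCurve ℚ) (ringClassField K ι (9 * p * ℓ)) ((φf ℓ).restrictScalars ℚ) (yf ℓ) = yf ℓ ∧
        ∀ (v : HeightOneSpectrum (𝓞 K)), ((3 : ℕ) : 𝓞 K) ∈ v.asIdeal →
          ∃ Φ : Subgroup (absoluteGaloisGroup (v.adicCompletion K)),
            IsOpen (Φ : Set (absoluteGaloisGroup (v.adicCompletion K))) ∧ IsCoprime (Φ.index : ℤ) ((2 : ℕ) : ℤ) ∧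
            ∀ τ ∈ Φ, (∀ x : ringClassField K ι (9 * p * ℓ), (show AlgebraicClosure K ≃ₐ[K] AlgebraicClosure K from
                resGal (K := K) (v.adicCompletion K) τ) (emb (9 * p * ℓ) x) = emb (9 * p * ℓ) x) ∨
              (∀ x : ringClassField K ι (9 * p * ℓ), (show AlgebraicClosure K ≃ₐ[K] AlgebraicClosure K from
                resGal (K := K) (v.adicCompletion K) τ) (emb (9 * p * ℓ) x) = emb (9 * p * ℓ) (φf ℓ x))) ∧
      (∀ (n a b : ℕ) (h : Kol a ∧ Kol b ∧ a ≠ b ∧ a * b = n),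
        Subgroup.zpowers (σL n a b) = ringClassGalOver ι (9 * p * n) (9 * p * a) ∧
        ∀ (hl : ringClassField K ι (9 * p * b) ≤ ringClassField K ι (9 * p * n)) (x : ringClassField K ι (9 * p * b)),
          σL n a b (RingClassField.inclusion ι hl x) = RingClassField.inclusion ι hl (σf b x)) ∧
      (∀ (n : ℕ), (∃ a b, Kol a ∧ Kol b ∧ a ≠ b ∧ a * b = n) →
        Affine.Point.map (W' := (⟨0, 0, 1, 0, -1⟩ : WeierstrassCurve ℚ)) (ringClassField K ι (9 * p * n)).subtype.toRatAlgHom (y2 n) =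
          Dt.φ (heegnerTau ((n : ℤ) ^ 2 * (81 * ((p : ℤ) ^ 2 + 4 * p + 16)),
            (n : ℤ) * (-(9 * (4 * (p : ℤ) ^ 2 + 17 * p + 72))), 4 * (p : ℤ) ^ 2 + 18 * p + 81)) ∧
        (∀ (hle : ringClassField K ι (9 * p) ≤ ringClassField K ι (9 * p * n)) (x : ringClassField K ι (9 * p)),
          φ2 n (RingClassField.inclusion ι hle x) = RingClassField.inclusion ι hle (s x)) ∧
        pointGalHom (⟨0, 0, 1, 0, -1⟩ : WeierstrassCurve ℚ) (ringClassField K ι (9 * p * n)) ((φ2 n).restrictScalars ℚ) (y2 n) = y2 n ∧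
        ∀ (v : HeightOneSpectrum (𝓞 K)), ((3 : ℕ) : 𝓞 K) ∈ v.asIdeal →
          ∃ Φ : Subgroup (absoluteGaloisGroup (v.adicCompletion K)),
            IsOpen (Φ : Set (absoluteGaloisGroup (v.adicCompletion K))) ∧ IsCoprime (Φ.index : ℤ) ((2 : ℕ) : ℤ) ∧
            ∀ τ ∈ Φ, (∀ x : ringClassField K ι (9 * p * n), (show AlgebraicClosure K ≃ₐ[K] AlgebraicClosure K from
                resGal (K := K) (v.adicCompletion K) τ) (emb (9 * p * n) x) = emb (9 * p * n) x) ∨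
              (∀ x : ringClassField K ι (9 * p * n), (show AlgebraicClosure K ≃ₐ[K] AlgebraicClosure K from
                resGal (K := K) (v.adicCompletion K) τ) (emb (9 * p * n) x) = emb (9 * p * n) (φ2 n x))) := by
  have hK := JZero.isImaginaryQuadratic_of_sq_add_self_add_one hω h2
  have hp0 : p ≠ 0 := hp.ne_zero
  have hm0 : 9 * p ≠ 0 := mul_ne_zero (by norm_num) hp0
  have hKol3 : ∀ ℓ, Kol ℓ → ℓ % 3 = 2 ∧ ¬ ℓ ∣ p := fun ℓ h ↦
    mod_three_eq_two_of_clause hω h2 hp hp3 (hKol ℓ h).1 (hKol ℓ h).2.2.2.1 (hKol ℓ h).2.2.2.2.2.2.2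
  have hKol9p : ∀ ℓ, Kol ℓ → ¬ ℓ ∣ 9 * p := by
    intro ℓ h hd
    obtain ⟨hℓ3, hℓp⟩ := hKol3 ℓ h
    rcases (Nat.Prime.dvd_mul (hKol ℓ h).1).mp hd with h9 | hp'
    · have : ℓ ∣ 3 ^ 2 := by norm_num; exact h9
      have := (Nat.prime_dvd_prime_iff_eq (hKol ℓ h).1 Nat.prime_three).mp ((hKol ℓ h).1.dvd_of_dvd_pow this)
      omega
    · exact hℓp hp'
  -- ### per prime: the generator `σ_ℓ`, the CM point `y_ℓ`, the tower-fixing `φ_ℓ`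
  have hσex : ∀ ℓ, Kol ℓ → ∃ σ : ringClassField K ι (9 * p * ℓ) ≃ₐ[ℚ] ringClassField K ι (9 * p * ℓ),
      Subgroup.zpowers σ = ringClassGalOver ι (9 * p * ℓ) (9 * p) := by
    intro ℓ h
    have h' := RingClassGalOverCyclic.exists_zpowers_eq_ringClassGalOver_mul hK ι hm0 (hKol ℓ h).1 (hKol9p ℓ h)
      (hKol ℓ h).2.2.2.2.2.1
    rwa [show ℓ * (9 * p) = 9 * p * ℓ by ring] at h'
  let σf : (ℓ : ℕ) → (ringClassField K ι (9 * p * ℓ) ≃ₐ[ℚ] ringClassField K ι (9 * p * ℓ)) := fun ℓ ↦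
    if h : Kol ℓ then Classical.choose (hσex ℓ h) else 1
  have hσf : ∀ ℓ (h : Kol ℓ), Subgroup.zpowers (σf ℓ) = ringClassGalOver ι (9 * p * ℓ) (9 * p) := by
    intro ℓ h; simp only [σf, dif_pos h]; exact Classical.choose_spec (hσex ℓ h)
  have hyex : ∀ n : ℕ, n ≠ 0 → (∀ q ∈ n.primeFactors, q % 3 = 2) →
      ∃ y : ((⟨0, 0, 1, 0, -1⟩ : WeierstrassCurve ℚ).baseChange (ringClassField K ι (9 * p * n))).toAffine.Point,
      Affine.Point.map (W' := (⟨0, 0, 1, 0, -1⟩ : WeierstrassCurve ℚ)) (ringClassField K ι (9 * p * n)).subtype.toRatAlgHom y =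
        Dt.φ (heegnerTau ((n : ℤ) ^ 2 * (81 * ((p : ℤ) ^ 2 + 4 * p + 16)),
          (n : ℤ) * (-(9 * (4 * (p : ℤ) ^ 2 + 17 * p + 72))), 4 * (p : ℤ) ^ 2 + 18 * p + 81)) := fun n hn0 hn ↦
    exists_map_eq_phi_sylvesterTau_of_sq_add_self_add_one hω h2 ι Dt hp3 hn0 hn
  have hℓfac : ∀ ℓ, Kol ℓ → ∀ q ∈ ℓ.primeFactors, q % 3 = 2 := fun ℓ h q hq ↦ by
    rw [(hKol ℓ h).1.primeFactors, Finset.mem_singleton] at hq; rw [hq]; exact (hKol3 ℓ h).1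
  let yf : (ℓ : ℕ) → ((⟨0, 0, 1, 0, -1⟩ : WeierstrassCurve ℚ).baseChange (ringClassField K ι (9 * p * ℓ))).toAffine.Point := fun ℓ ↦
    if h : Kol ℓ then Classical.choose (hyex ℓ (hKol ℓ h).1.ne_zero (hℓfac ℓ h)) else 0
  have hyf : ∀ ℓ (h : Kol ℓ), Affine.Point.map (W' := (⟨0, 0, 1, 0, -1⟩ : WeierstrassCurve ℚ)) (ringClassField K ι (9 * p * ℓ)).subtype.toRatAlgHom (yf ℓ) =
      Dt.φ (heegnerTau ((ℓ : ℤ) ^ 2 * (81 * ((p : ℤ) ^ 2 + 4 * p + 16)),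
        (ℓ : ℤ) * (-(9 * (4 * (p : ℤ) ^ 2 + 17 * p + 72))), 4 * (p : ℤ) ^ 2 + 18 * p + 81)) := by
    intro ℓ h; simp only [yf, dif_pos h]; exact Classical.choose_spec (hyex ℓ (hKol ℓ h).1.ne_zero (hℓfac ℓ h))
  have hle : ∀ ℓ, Kol ℓ → ringClassField K ι (9 * p) ≤ ringClassField K ι (9 * p * ℓ) :=
    fun ℓ h ↦ ringClassField_nine_mul_le hK ι hp0 (hKol ℓ h).1.ne_zero
  have hφex := fun ℓ (h : Kol ℓ) ↦ hTFn ℓ (hKol ℓ h).1.ne_zero (hℓfac ℓ h) (hle ℓ h) (emb (9 * p * ℓ)) (hembK _) (yf ℓ) (hyf ℓ h)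
  let φf : (ℓ : ℕ) → (ringClassField K ι (9 * p * ℓ) ≃ₐ[K] ringClassField K ι (9 * p * ℓ)) := fun ℓ ↦
    if h : Kol ℓ then Classical.choose (hφex ℓ h) else 1
  have hφf : ∀ ℓ (h : Kol ℓ), φf ℓ = Classical.choose (hφex ℓ h) := by intro ℓ h; simp only [φf, dif_pos h]
  -- ### per pair level `n = a b`: the lifted generator `σL n a b`, the CM point `y_n`, the tower-fixing `φ2 n`
  have hlepair : ∀ n b : ℕ, b ∣ n → n ≠ 0 → ringClassField K ι (9 * p * b) ≤ ringClassField K ι (9 * p * n) :=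
    fun n b hb hn ↦ ringClassField_mono hK ι (mul_dvd_mul_left (9 * p) hb) (mul_ne_zero hm0 hn)
  have hliftex : ∀ (n a b : ℕ) (hl : ringClassField K ι (9 * p * b) ≤ ringClassField K ι (9 * p * n)),
      Kol a → Kol b → a ≠ b → a * b = n →
      ∃ σ' : ringClassField K ι (9 * p * n) ≃ₐ[ℚ] ringClassField K ι (9 * p * n),
        Subgroup.zpowers σ' = ringClassGalOver ι (9 * p * n) (9 * p * a) ∧
        ∀ x : ringClassField K ι (9 * p * b), σ' (RingClassField.inclusion ι hl x) = RingClassField.inclusion ι hl (σf b x) :=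
    fun n a b hl ha hb hne hab ↦ exists_generator_lift hK ι hp0 (hKol a ha).1 (hKol b hb).1 hne (hKol9p a ha) (hKol9p b hb)
      (hKol b hb).2.2.2.2.2.1 (m := 9 * p * n) (by rw [hab]) hl (hσf b hb)
  let σL : (n a b : ℕ) → (ringClassField K ι (9 * p * n) ≃ₐ[ℚ] ringClassField K ι (9 * p * n)) := fun n a b ↦
    if h : Kol a ∧ Kol b ∧ a ≠ b ∧ a * b = n then
      Classical.choose (hliftex n a b (hlepair n b (Dvd.intro_left a h.2.2.2) (h.2.2.2 ▸ mul_ne_zero (hKol a h.1).1.ne_zero (hKol b h.2.1).1.ne_zero))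
        h.1 h.2.1 h.2.2.1 h.2.2.2)
    else 1
  have hn2 : ∀ n : ℕ, (∃ a b, Kol a ∧ Kol b ∧ a ≠ b ∧ a * b = n) → n ≠ 0 ∧ ∀ q ∈ n.primeFactors, q % 3 = 2 := by
    rintro n ⟨a, b, ha, hb, hne, hab⟩
    refine ⟨hab ▸ mul_ne_zero (hKol a ha).1.ne_zero (hKol b hb).1.ne_zero, fun q hq ↦ ?_⟩
    rw [← hab, Nat.primeFactors_mul (hKol a ha).1.ne_zero (hKol b hb).1.ne_zero, Finset.mem_union, (hKol a ha).1.primeFactors,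
      (hKol b hb).1.primeFactors, Finset.mem_singleton, Finset.mem_singleton] at hq
    rcases hq with h1 | h1 <;> rw [h1]
    · exact (hKol3 a ha).1
    · exact (hKol3 b hb).1
  let y2 : (n : ℕ) → ((⟨0, 0, 1, 0, -1⟩ : WeierstrassCurve ℚ).baseChange (ringClassField K ι (9 * p * n))).toAffine.Point := fun n ↦
    if h : (∃ a b, Kol a ∧ Kol b ∧ a ≠ b ∧ a * b = n) then Classical.choose (hyex n (hn2 n h).1 (hn2 n h).2) else 0
  have hy2 : ∀ (n : ℕ) (h : ∃ a b, Kol a ∧ Kol b ∧ a ≠ b ∧ a * b = n),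
      Affine.Point.map (W' := (⟨0, 0, 1, 0, -1⟩ : WeierstrassCurve ℚ)) (ringClassField K ι (9 * p * n)).subtype.toRatAlgHom (y2 n) =
        Dt.φ (heegnerTau ((n : ℤ) ^ 2 * (81 * ((p : ℤ) ^ 2 + 4 * p + 16)),
          (n : ℤ) * (-(9 * (4 * (p : ℤ) ^ 2 + 17 * p + 72))), 4 * (p : ℤ) ^ 2 + 18 * p + 81)) := by
    intro n h; simp only [y2, dif_pos h]; exact Classical.choose_spec (hyex n (hn2 n h).1 (hn2 n h).2)
  have hle2 : ∀ n, (∃ a b, Kol a ∧ Kol b ∧ a ≠ b ∧ a * b = n) → ringClassField K ι (9 * p) ≤ ringClassField K ι (9 * p * n) :=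
    fun n h ↦ ringClassField_nine_mul_le hK ι hp0 (hn2 n h).1
  have hφ2ex := fun n (h : ∃ a b, Kol a ∧ Kol b ∧ a ≠ b ∧ a * b = n) ↦
    hTFn n (hn2 n h).1 (hn2 n h).2 (hle2 n h) (emb (9 * p * n)) (hembK _) (y2 n) (hy2 n h)
  let φ2 : (n : ℕ) → (ringClassField K ι (9 * p * n) ≃ₐ[K] ringClassField K ι (9 * p * n)) := fun n ↦
    if h : (∃ a b, Kol a ∧ Kol b ∧ a ≠ b ∧ a * b = n) then Classical.choose (hφ2ex n h) else 1
  have hφ2 : ∀ n (h : ∃ a b, Kol a ∧ Kol b ∧ a ≠ b ∧ a * b = n), φ2 n = Classical.choose (hφ2ex n h) := by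
    intro n h; simp only [φ2, dif_pos h]
  -- the restriction clause is proof-irrelevant in `hle`
  have hincl : ∀ {m : ℕ} (h₁ h₂ : ringClassField K ι (9 * p) ≤ ringClassField K ι m) (x : ringClassField K ι (9 * p)),
      RingClassField.inclusion ι h₁ x = RingClassField.inclusion ι h₂ x := fun _ _ _ ↦ rfl
  refine ⟨σf, yf, φf, σL, y2, φ2, fun ℓ h ↦ ⟨hσf ℓ h, hyf ℓ h, ?_, ?_, ?_⟩, fun n a b h ↦ ?_, fun n h ↦ ⟨hy2 n h, ?_, ?_, ?_⟩⟩
  · intro hle' x; rw [hφf ℓ h, hincl hle' (hle ℓ h)]; exact (Classical.choose_spec (hφex ℓ h)).1 x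
  · rw [hφf ℓ h]; exact (Classical.choose_spec (hφex ℓ h)).2.1
  · rw [hφf ℓ h]; exact (Classical.choose_spec (hφex ℓ h)).2.2
  · simp only [σL, dif_pos h]
    obtain ⟨h1, h2'⟩ := Classical.choose_spec (hliftex n a b (hlepair n b (Dvd.intro_left a h.2.2.2)
      (h.2.2.2 ▸ mul_ne_zero (hKol a h.1).1.ne_zero (hKol b h.2.1).1.ne_zero)) h.1 h.2.1 h.2.2.1 h.2.2.2)
    exact ⟨h1, fun hl x ↦ h2' x⟩
  · intro hle' x; rw [hφ2 n h, hincl hle' (hle2 n h)]; exact (Classical.choose_spec (hφ2ex n h)).1 x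
  · rw [hφ2 n h]; exact (Classical.choose_spec (hφ2ex n h)).2.1
  · rw [hφ2 n h]; exact (Classical.choose_spec (hφ2ex n h)).2.2

end Summit.BirchSwinnertonDyer.BirchSwinnertonDyer.Theorems.SylvesterTwoCMHalf

end
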